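import Summits.PneNP.PneNP.Theorems.PhaseTwinsNoFBPPApproxAboveUniquenessLever
import Summits.PneNP.PneNP.Theorems.PhaseTwinsNoFBPPApproxAboveUniquenessSharpP
import Summits.PneNP.PneNP.Theorems.NoFBPPApproxAboveUniqueness.Negative.FPRASDictionary

/-!
# Theorem N of crux stmt-PneNP-2717 (Negative lane): `NP ⊆ BPP → ¬ NoFBPPApproxAboveUniqueness`

Line `SketchIdeator1` (card `stockmeyer-bpp-calibration`). A negative lemma modulo the (believed false)
hypothesis `H := NP ⊆ BPP`, kernel-checked with NO named fact: under `H` every `#P` function has an FPRAS (the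
lever `hasFPRAS_of_sharpP_of_NP_subset_BPP`: oracle-free Stockmeyer, `BPP^BPP = BPP` inside the approximate
counter), in particular the hard-core count at every `(Δ, p, q)` (`hardcoreCount_mem_SharpP`, the route's
support item stmt-PneNP-2722, proved), which is exactly a disproof of the crux (`Negative.not_crux_of_hasFPRAS`).
The converse (fact-free, via the tree's proved PCP theorem) and the resulting calibration
`NoFBPPApproxAboveUniqueness ⟺ ¬(NP ⊆ BPP)` are in `Theorems/PhaseTwinsNoFBPPApproxAboveUniquenessCalibration.lean`.
-/

set_option linter.dupNamespace false

namespace Summit.PneNP.PneNP.Theorems.NoFBPPApproxAboveUniqueness.Negative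

open Literature.Computability.Complexity
open Summit.PneNP.PneNP.Theses.PhaseTwins (NoFBPPApproxAboveUniqueness)

/-- **Theorem N.** `NP ⊆ BPP → ¬ NoFBPPApproxAboveUniqueness` (negative lemma modulo `NP ⊆ BPP`; registered
sub-goal of the line). [folklore] -/
theorem noFBPPApproxAboveUniqueness_false_of_NP_subset_BPP : Nondeterministic.NP ⊆ BPP → ¬ NoFBPPApproxAboveUniqueness :=
  fun hNP => not_crux_of_hasFPRAS fun Δ p q _ _ _ =>
    hasFPRAS_of_sharpP_of_NP_subset_BPP hNP (hardcoreCount_mem_SharpP Δ p q)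

end Summit.PneNP.PneNP.Theorems.NoFBPPApproxAboveUniqueness.Negative
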